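import Summits.CriticalPhenomena.CardyFormulaZ2.Theorems.CardyComplexConeDefs
import Literature.Probability.LatticeModels.LatticeDobrushinBox
import Literature.Probability.Percolation.HalfPlaneOneArmQuasiMultiplicativity
import Literature.Probability.Percolation.HalfPlaneArmAxisInputs
import Literature.Probability.Percolation.LatticeSymmetry

/-!
# Stub `halfBoxArm_le_threeSided_conn` (N5) of line `qkz-strip-boundary-arm`
(crux `EdgePrecompact`, stmt-CriticalPhenomena-11387)

RSW / Harris–FKG comparability, uniformly in the position `x ∈ [2n, 4n]` of the wall site
`(x, 0)`, of
* the centred half-box one-arm probability of bond percolation on `ℤ²` at `p = 1/2` at scale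
  `2n`, `P[0 ↔ {y₀ = ±2n} ∪ {y₁ = 2n} in [-2n, 2n] × [0, 2n]]`, and
* the probability that `(x, 0)` is joined by an open path inside the box `[0, 6n] × [0, 3n]` to
  the wired arc `A = {x₀ = 0} ∪ {x₀ = 6n} ∪ {x₁ = 3n}` of the three-sided box
  `LatticeDobrushin.threeSided (6n) (3n)`.

Proof (Nolin 2008, §4.3/§4.6 gluing near a straight boundary, as packaged in the tree's abstract
half-plane arm layer `HalfPlaneArm.*`, instantiated for the axis coordinates `X v = v 0`,
`Y v = v 1` by `HalfPlaneArmAxisInputs`):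
1. `axisArm_eq` + translation invariance (`real_openCrossing_shift`): the centred arm event has
   the probability of the arm event based at `b = (x, 0)`, an open path from `b` to half-plane
   distance `2n` inside `armbox[b, 2n] = [x - 2n, x + 2n] × [0, 2n]` (`real_arm_shift_le_N5`).
2. Deterministic gluing (`conn_top_of_arm_U_tb_N5`): on the U event `U[b, n]` (two pillars and a
   bar, `HalfPlaneArm.uCatch`) the arm is joined to the left end of the bar crossing of
   `[x - 2n, x + 2n] × [n, 2n]`; an open top–bottom crossing of `[x - 2n, x + 2n] × [n, 3n]` meets
   the bar crossing (`HalfPlaneArm.meet`); chaining gives an open path from `b` to the row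
   `{x₁ = 3n} ⊆ A` inside the column `[x - 2n, x + 2n] × [0, 3n] ⊆ [0, 6n] × [0, 3n]`.
3. Harris–FKG (`harris₃`) with the RSW lower bounds `real_U_ge`, `tb_lower` (constants free of
   `n` and `x`): `c_U c_T · P(arm) ≤ P(arm ∩ U ∩ TB) ≤ P(b ↔ A)` (`key_N5`).
-/

namespace Summit.CriticalPhenomena.CardyFormulaZ2.Cruxes.EdgePrecompact.QkzStripBoundaryArm

open MeasureTheory Filter Set Metric
open scoped Topology BigOperators Pointwise
open Literature.Probability.LatticeModels Literature.Probability.Percolation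
open Literature.Probability.RandomPlanarGeometry (DobrushinDomain)
open Summit.CriticalPhenomena.CardyFormulaZ2.Theses.CardyComplexCone

noncomputable section

/-- `0 < √2` (the scale of the isoradial drawing `squareLatticeEmbedding = √2 ℤ²`). -/
private theorem sqrt_two_pos_N5 : (0 : ℝ) < Real.sqrt 2 := by positivity

/-- **Deterministic gluing.** On a lattice configuration lying in the arm event based at `b`
(`0 ≤ b₁`) at half-plane distance `2a`, in the U event `U[b, a]` (pillars
`[b₀ + a, b₀ + 2a] × [0, b₁ + 2a]`, `[b₀ - 2a, b₀ - a] × [0, b₁ + 2a]` crossed top–bottom, bar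
`[b₀ - 2a, b₀ + 2a] × [b₁ + a, b₁ + 2a]` crossed left–right) and in the top–bottom crossing event
of `[b₀ - 2a, b₀ + 2a] × [b₁ + a, b₁ + 3a]`, the base point `b` is joined to a site of the row
`{y₁ = b₁ + 3a}` by an open path inside the column `[b₀ - 2a, b₀ + 2a] × [0, b₁ + 3a]`: the U
catches the arm (`HalfPlaneArm.uCatch`), and the tall crossing meets the bar (`HalfPlaneArm.meet`). -/
private theorem conn_top_of_arm_U_tb_N5 {ω : BondConfig (Site 2)} (hω : ω ⊆ (zdGraph 2).edgeSet)
    {b : Site 2} (hb : 0 ≤ b 1) {a : ℤ} (ha : 1 ≤ a)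
    (hArm : ω ∈ openCrossing {v : Site 2 | 0 ≤ v 1 ∧ max |v 0 - b 0| (v 1 - b 1) ≤ 2 * a} {b}
      {v : Site 2 | max |v 0 - b 0| (v 1 - b 1) = 2 * a})
    (hU : ω ∈ openCrossing {v : Site 2 | b 0 + a ≤ v 0 ∧ v 0 ≤ b 0 + 2 * a ∧ 0 ≤ v 1 ∧ v 1 ≤ b 1 + 2 * a}
          {v : Site 2 | v 1 = 0} {v : Site 2 | v 1 = b 1 + 2 * a} ∩
        openCrossing {v : Site 2 | b 0 - 2 * a ≤ v 0 ∧ v 0 ≤ b 0 + 2 * a ∧ b 1 + a ≤ v 1 ∧ v 1 ≤ b 1 + 2 * a}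
          {v : Site 2 | v 0 = b 0 - 2 * a} {v : Site 2 | v 0 = b 0 + 2 * a} ∩
        openCrossing {v : Site 2 | b 0 - 2 * a ≤ v 0 ∧ v 0 ≤ b 0 - a ∧ 0 ≤ v 1 ∧ v 1 ≤ b 1 + 2 * a}
          {v : Site 2 | v 1 = 0} {v : Site 2 | v 1 = b 1 + 2 * a})
    (hT : ω ∈ openCrossing
        {v : Site 2 | b 0 - 2 * a ≤ v 0 ∧ v 0 ≤ b 0 + 2 * a ∧ b 1 + a ≤ v 1 ∧ v 1 ≤ b 1 + 3 * a}
        {v : Site 2 | v 1 = b 1 + a} {v : Site 2 | v 1 = b 1 + 3 * a}) :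
    ∃ y : Site 2, y 1 = b 1 + 3 * a ∧ b 0 - 2 * a ≤ y 0 ∧ y 0 ≤ b 0 + 2 * a ∧
      ω ∈ openConnIn {v : Site 2 | b 0 - 2 * a ≤ v 0 ∧ v 0 ≤ b 0 + 2 * a ∧ 0 ≤ v 1 ∧ v 1 ≤ b 1 + 3 * a}
        b y := by
  obtain ⟨x₀, hx₀, y, hy, hxy⟩ := hArm
  rw [mem_singleton_iff] at hx₀
  rw [hx₀] at hxy
  have hy : max |y 0 - b 0| (y 1 - b 1) = 2 * a := hy
  obtain ⟨⟨⟨xR, hxR, yR, hyR, hR⟩, ⟨xB, hxB, yB, hyB, hBar⟩⟩, ⟨xL, hxL, yL, hyL, hL⟩⟩ := hU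
  have exB : xB 0 = b 0 - 2 * a := hxB
  have eyB : yB 0 = b 0 + 2 * a := hyB
  -- the U catches the arm: `b ↔ xB` inside `armbox ∪ Ubox`
  have h1 := HalfPlaneArm.uCatch (X := fun v : Site 2 => v 0) (Y := fun v : Site 2 => v 1)
    HalfPlaneArm.axis_X_le HalfPlaneArm.axis_Y_le (emb := squareLatticeEmbedding)
    isIsoradial_squareLatticeEmbedding_holds isRhombicTiling_squareLatticeEmbedding_holds
    (κ := Real.sqrt 2) sqrt_two_pos_N5 HalfPlaneArm.axis_re HalfPlaneArm.axis_im hω hb ha hBar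
    hxB hyB hR hxR hyR hL hxL hyL
    (S := {v : Site 2 | 0 ≤ v 1 ∧ max |v 0 - b 0| (v 1 - b 1) ≤ 2 * a}) (fun v hv => hv.1) hxy
    (by simp only [sub_self, abs_zero, max_self]; omega) hy.ge
  -- the tall top–bottom crossing meets the bar: `xB ↔ v ↔ yT`
  obtain ⟨xT, hxT, yT, hyT, hTc⟩ := hT
  have exT : xT 1 = b 1 + a := hxT
  have eyT : yT 1 = b 1 + 3 * a := hyT
  obtain ⟨v, -, -, ⟨x2, hx2, hBv⟩, -, -, ⟨y2, hy2, hvT⟩⟩ := HalfPlaneArm.meet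
    (X := fun v : Site 2 => v 0) (Y := fun v : Site 2 => v 1) (emb := squareLatticeEmbedding)
    isIsoradial_squareLatticeEmbedding_holds isRhombicTiling_squareLatticeEmbedding_holds
    (κ := Real.sqrt 2) sqrt_two_pos_N5 HalfPlaneArm.axis_re HalfPlaneArm.axis_im hω
    (S := {v : Site 2 | b 0 - 2 * a ≤ v 0 ∧ v 0 ≤ b 0 + 2 * a ∧ b 1 + a ≤ v 1 ∧ v 1 ≤ b 1 + 2 * a})
    (A := {xB}) (B := {yB})
    (S' := {v : Site 2 | b 0 - 2 * a ≤ v 0 ∧ v 0 ≤ b 0 + 2 * a ∧ b 1 + a ≤ v 1 ∧ v 1 ≤ b 1 + 3 * a})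
    (A' := {xT}) (B' := {yT}) (a₁ := b 0 - 2 * a) (a₂ := b 0 + 2 * a) (c₁ := b 1 + a)
    (c₂ := b 1 + 2 * a) (by omega) (by omega) (fun v hv => hv.2.2)
    (fun v hv => by rw [mem_singleton_iff.1 hv]; omega)
    (fun v hv => by rw [mem_singleton_iff.1 hv]; omega) (fun v hv => ⟨hv.1, hv.2.1⟩)
    (fun v hv => by rw [mem_singleton_iff.1 hv]; omega)
    (fun v hv => by rw [mem_singleton_iff.1 hv]; omega)
    ⟨xB, mem_singleton _, yB, mem_singleton _, hBar⟩ ⟨xT, mem_singleton _, yT, mem_singleton _, hTc⟩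
  rw [mem_singleton_iff.1 hx2] at hBv
  rw [mem_singleton_iff.1 hy2] at hvT
  refine ⟨yT, eyT, hvT.2.1.1, hvT.2.1.2.1, ?_⟩
  -- chain `b ↔ xB ↔ v ↔ yT`, everything inside the column
  refine HalfPlaneArm.conn_trans subset_rfl (fun w hw => ?_)
    (HalfPlaneArm.conn_trans (fun w hw => ?_) (fun w hw => ?_) h1 hBv) hvT
  · exact ⟨hw.1, hw.2.1, by have := hw.2.2.1; omega, hw.2.2.2⟩
  · rcases hw with hw | hw
    · obtain ⟨h0, hm⟩ := hw
      rw [max_le_iff, abs_le] at hm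
      exact ⟨by omega, by omega, h0, by omega⟩
    · exact ⟨hw.1, hw.2.1, hw.2.2.1, by have := hw.2.2.2; omega⟩
  · exact ⟨hw.1, hw.2.1, by have := hw.2.2.1; omega, by have := hw.2.2.2; omega⟩

/-- **Translation invariance**: the centred half-box arm event at scale `m` (in the abstract form
of `HalfPlaneArm.axisArm_eq`) is at most as likely as — in fact exactly as likely as — the arm
event based at a point `b` of the axis `{b₁ = 0}` (`real_openCrossing_shift` by `b`, and the
translated sets are the sets of the arm event at `b`). -/
private theorem real_arm_shift_le_N5 {b : Site 2} (hb : b 1 = 0) (m : ℤ) :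
    (bondPercolation (zdGraph 2) half).real
        (openCrossing {v : Site 2 | 0 ≤ v 1 ∧ max |v 0 - (0 : Site 2) 0| (v 1 - (0 : Site 2) 1) ≤ m}
          {0} {v : Site 2 | max |v 0 - (0 : Site 2) 0| (v 1 - (0 : Site 2) 1) = m}) ≤
      (bondPercolation (zdGraph 2) half).real
        (openCrossing {v : Site 2 | 0 ≤ v 1 ∧ max |v 0 - b 0| (v 1 - b 1) ≤ m} {b}
          {v : Site 2 | max |v 0 - b 0| (v 1 - b 1) = m}) := by
  rw [← real_openCrossing_shift half b]
  refine measureReal_mono (openCrossing_mono ?_ ?_ ?_) (measure_ne_top _ _)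
  · rintro _ ⟨v, hv, rfl⟩
    obtain ⟨h0, hm⟩ := hv
    rw [max_le_iff, abs_le] at hm
    simp only [Pi.zero_apply, sub_zero] at hm
    simp only [mem_setOf_eq, Pi.add_apply, add_sub_cancel_right, max_le_iff, abs_le]
    omega
  · rintro _ ⟨v, hv, rfl⟩
    rw [mem_singleton_iff] at hv ⊢
    rw [hv]
    exact zero_add b
  · rintro _ ⟨v, hv, rfl⟩
    have hv : max |v 0 - (0 : Site 2) 0| (v 1 - (0 : Site 2) 1) = m := hv
    simp only [Pi.zero_apply, sub_zero] at hv
    show max |(v + b) 0 - b 0| ((v + b) 1 - b 1) = m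
    simpa only [Pi.add_apply, add_sub_cancel_right] using hv

/-- **Harris–FKG step.** For a base point `b` on the axis and a scale `a ≥ 1`, lower bounds `cU`,
`cT` for the probabilities of the U event `U[b, a]` and of the top–bottom crossing of
`[b₀ - 2a, b₀ + 2a] × [a, 3a]` give
`cU · cT · P(arm[b, 2a]) ≤ P(b ↔ {y₁ = 3a} inside [b₀ - 2a, b₀ + 2a] × [0, 3a])`
(`harris₃` for the three increasing events, then `conn_top_of_arm_U_tb_N5` almost surely). -/
private theorem key_N5 {cU cT : ℝ} (hcT : 0 < cT) {b : Site 2} (hb : b 1 = 0)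
    {a : ℤ} (ha : 1 ≤ a)
    (eU : cU ≤ (bondPercolation (zdGraph 2) half).real
      (openCrossing {v : Site 2 | b 0 + a ≤ v 0 ∧ v 0 ≤ b 0 + 2 * a ∧ 0 ≤ v 1 ∧ v 1 ≤ b 1 + 2 * a}
          {v : Site 2 | v 1 = 0} {v : Site 2 | v 1 = b 1 + 2 * a} ∩
        openCrossing {v : Site 2 | b 0 - 2 * a ≤ v 0 ∧ v 0 ≤ b 0 + 2 * a ∧ b 1 + a ≤ v 1 ∧ v 1 ≤ b 1 + 2 * a}
          {v : Site 2 | v 0 = b 0 - 2 * a} {v : Site 2 | v 0 = b 0 + 2 * a} ∩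
        openCrossing {v : Site 2 | b 0 - 2 * a ≤ v 0 ∧ v 0 ≤ b 0 - a ∧ 0 ≤ v 1 ∧ v 1 ≤ b 1 + 2 * a}
          {v : Site 2 | v 1 = 0} {v : Site 2 | v 1 = b 1 + 2 * a}))
    (eT : cT ≤ (bondPercolation (zdGraph 2) half).real (openCrossing
        {v : Site 2 | b 0 - 2 * a ≤ v 0 ∧ v 0 ≤ b 0 + 2 * a ∧ b 1 + a ≤ v 1 ∧ v 1 ≤ b 1 + 3 * a}
        {v : Site 2 | v 1 = b 1 + a} {v : Site 2 | v 1 = b 1 + 3 * a})) :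
    cU * cT * (bondPercolation (zdGraph 2) half).real
        (openCrossing {v : Site 2 | 0 ≤ v 1 ∧ max |v 0 - b 0| (v 1 - b 1) ≤ 2 * a} {b}
          {v : Site 2 | max |v 0 - b 0| (v 1 - b 1) = 2 * a}) ≤
      (bondPercolation (zdGraph 2) half).real {ω : BondConfig (Site 2) | ∃ y : Site 2,
        y 1 = b 1 + 3 * a ∧ b 0 - 2 * a ≤ y 0 ∧ y 0 ≤ b 0 + 2 * a ∧
        ω ∈ openConnIn {v : Site 2 | b 0 - 2 * a ≤ v 0 ∧ v 0 ≤ b 0 + 2 * a ∧ 0 ≤ v 1 ∧ v 1 ≤ b 1 + 3 * a}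
          b y} := by
  have finB := HalfPlaneArm.box_finite (X := fun v : Site 2 => v 0) (Y := fun v : Site 2 => v 1)
    HalfPlaneArm.axis_injective
  have mA : MeasurableSet (openCrossing {v : Site 2 | 0 ≤ v 1 ∧ max |v 0 - b 0| (v 1 - b 1) ≤ 2 * a}
      {b} {v : Site 2 | max |v 0 - b 0| (v 1 - b 1) = 2 * a}) :=
    HalfPlaneArm.measurableSet_openCrossing_of_finite
      (HalfPlaneArm.armbox_finite (X := fun v : Site 2 => v 0) (Y := fun v : Site 2 => v 1)
        HalfPlaneArm.axis_injective b (2 * a)) _ _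
  have mU : MeasurableSet
      (openCrossing {v : Site 2 | b 0 + a ≤ v 0 ∧ v 0 ≤ b 0 + 2 * a ∧ 0 ≤ v 1 ∧ v 1 ≤ b 1 + 2 * a}
          {v : Site 2 | v 1 = 0} {v : Site 2 | v 1 = b 1 + 2 * a} ∩
        openCrossing {v : Site 2 | b 0 - 2 * a ≤ v 0 ∧ v 0 ≤ b 0 + 2 * a ∧ b 1 + a ≤ v 1 ∧ v 1 ≤ b 1 + 2 * a}
          {v : Site 2 | v 0 = b 0 - 2 * a} {v : Site 2 | v 0 = b 0 + 2 * a} ∩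
        openCrossing {v : Site 2 | b 0 - 2 * a ≤ v 0 ∧ v 0 ≤ b 0 - a ∧ 0 ≤ v 1 ∧ v 1 ≤ b 1 + 2 * a}
          {v : Site 2 | v 1 = 0} {v : Site 2 | v 1 = b 1 + 2 * a}) :=
    ((HalfPlaneArm.measurableSet_openCrossing_of_finite (finB _ _ _ _) _ _).inter
      (HalfPlaneArm.measurableSet_openCrossing_of_finite (finB _ _ _ _) _ _)).inter
      (HalfPlaneArm.measurableSet_openCrossing_of_finite (finB _ _ _ _) _ _)
  have mT : MeasurableSet (openCrossing
      {v : Site 2 | b 0 - 2 * a ≤ v 0 ∧ v 0 ≤ b 0 + 2 * a ∧ b 1 + a ≤ v 1 ∧ v 1 ≤ b 1 + 3 * a}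
      {v : Site 2 | v 1 = b 1 + a} {v : Site 2 | v 1 = b 1 + 3 * a}) :=
    HalfPlaneArm.measurableSet_openCrossing_of_finite (finB _ _ _ _) _ _
  have uU : IsUpperSet
      (openCrossing {v : Site 2 | b 0 + a ≤ v 0 ∧ v 0 ≤ b 0 + 2 * a ∧ 0 ≤ v 1 ∧ v 1 ≤ b 1 + 2 * a}
          {v : Site 2 | v 1 = 0} {v : Site 2 | v 1 = b 1 + 2 * a} ∩
        openCrossing {v : Site 2 | b 0 - 2 * a ≤ v 0 ∧ v 0 ≤ b 0 + 2 * a ∧ b 1 + a ≤ v 1 ∧ v 1 ≤ b 1 + 2 * a}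
          {v : Site 2 | v 0 = b 0 - 2 * a} {v : Site 2 | v 0 = b 0 + 2 * a} ∩
        openCrossing {v : Site 2 | b 0 - 2 * a ≤ v 0 ∧ v 0 ≤ b 0 - a ∧ 0 ≤ v 1 ∧ v 1 ≤ b 1 + 2 * a}
          {v : Site 2 | v 1 = 0} {v : Site 2 | v 1 = b 1 + 2 * a}) :=
    ((isUpperSet_openCrossing _ _ _).inter (isUpperSet_openCrossing _ _ _)).inter
      (isUpperSet_openCrossing _ _ _)
  have h3 := HalfPlaneArm.harris₃ half (isUpperSet_openCrossing _ _ _) uU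
    (isUpperSet_openCrossing _ _ _) mA mU mT
  have hsub : (bondPercolation (zdGraph 2) half).real
      (openCrossing {v : Site 2 | 0 ≤ v 1 ∧ max |v 0 - b 0| (v 1 - b 1) ≤ 2 * a} {b}
          {v : Site 2 | max |v 0 - b 0| (v 1 - b 1) = 2 * a} ∩
        (openCrossing {v : Site 2 | b 0 + a ≤ v 0 ∧ v 0 ≤ b 0 + 2 * a ∧ 0 ≤ v 1 ∧ v 1 ≤ b 1 + 2 * a}
            {v : Site 2 | v 1 = 0} {v : Site 2 | v 1 = b 1 + 2 * a} ∩
          openCrossing {v : Site 2 | b 0 - 2 * a ≤ v 0 ∧ v 0 ≤ b 0 + 2 * a ∧ b 1 + a ≤ v 1 ∧ v 1 ≤ b 1 + 2 * a}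
            {v : Site 2 | v 0 = b 0 - 2 * a} {v : Site 2 | v 0 = b 0 + 2 * a} ∩
          openCrossing {v : Site 2 | b 0 - 2 * a ≤ v 0 ∧ v 0 ≤ b 0 - a ∧ 0 ≤ v 1 ∧ v 1 ≤ b 1 + 2 * a}
            {v : Site 2 | v 1 = 0} {v : Site 2 | v 1 = b 1 + 2 * a}) ∩
        openCrossing
          {v : Site 2 | b 0 - 2 * a ≤ v 0 ∧ v 0 ≤ b 0 + 2 * a ∧ b 1 + a ≤ v 1 ∧ v 1 ≤ b 1 + 3 * a}
          {v : Site 2 | v 1 = b 1 + a} {v : Site 2 | v 1 = b 1 + 3 * a}) ≤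
      (bondPercolation (zdGraph 2) half).real {ω : BondConfig (Site 2) | ∃ y : Site 2,
        y 1 = b 1 + 3 * a ∧ b 0 - 2 * a ≤ y 0 ∧ y 0 ≤ b 0 + 2 * a ∧
        ω ∈ openConnIn {v : Site 2 | b 0 - 2 * a ≤ v 0 ∧ v 0 ≤ b 0 + 2 * a ∧ 0 ≤ v 1 ∧ v 1 ≤ b 1 + 3 * a}
          b y} := by
    refine ENNReal.toReal_mono (measure_ne_top _ _) (measure_mono_ae ?_)
    filter_upwards [ae_subset_edgeSet (zdGraph 2) half] with ω hω h
    exact conn_top_of_arm_U_tb_N5 hω hb.ge ha h.1.1 h.1.2 h.2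
  calc cU * cT * (bondPercolation (zdGraph 2) half).real
        (openCrossing {v : Site 2 | 0 ≤ v 1 ∧ max |v 0 - b 0| (v 1 - b 1) ≤ 2 * a} {b}
          {v : Site 2 | max |v 0 - b 0| (v 1 - b 1) = 2 * a})
      = (bondPercolation (zdGraph 2) half).real
        (openCrossing {v : Site 2 | 0 ≤ v 1 ∧ max |v 0 - b 0| (v 1 - b 1) ≤ 2 * a} {b}
          {v : Site 2 | max |v 0 - b 0| (v 1 - b 1) = 2 * a}) * cU * cT := by ring
    _ ≤ _ := by gcongr
    _ ≤ _ := h3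
    _ ≤ _ := hsub

/-- **N5 — the half-box arm is comparable with the connection to the wired arc of the three-sided
box.** There are `c > 0` and `n₀` such that for all `n ≥ n₀` and all `x ∈ [2n, 4n]`,
`c · P_{1/2}[0 ↔ {y₀ = ±2n} ∪ {y₁ = 2n} in [-2n, 2n] × [0, 2n]] ≤
 P_{1/2}[(x, 0) ↔ A in [0, 6n] × [0, 3n]]`, `A` the wired arc of
`LatticeDobrushin.threeSided (6n) (3n)` (translation invariance, the U of box crossings catching
the arm, a top–bottom crossing above it, Harris–FKG and RSW; Nolin 2008, §4.3 and §4.6). -/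
theorem halfBoxArm_le_threeSided_conn : ∃ c : ℝ, 0 < c ∧ ∃ n₀ : ℕ, ∀ n : ℕ, n₀ ≤ n → ∀ x : ℕ, 2 * n ≤ x → x ≤ 4 * n → c * (bondPercolation (zdGraph 2) half).real {ω : BondConfig (Site 2) | ∃ y : Site 2, (y 0 = ((2 * n : ℕ) : ℤ) ∨ y 0 = -((2 * n : ℕ) : ℤ) ∨ y 1 = ((2 * n : ℕ) : ℤ)) ∧ ω ∈ openConnIn {v : Site 2 | 0 ≤ v 1 ∧ -((2 * n : ℕ) : ℤ) ≤ v 0 ∧ v 0 ≤ ((2 * n : ℕ) : ℤ) ∧ v 1 ≤ ((2 * n : ℕ) : ℤ)} 0 y} ≤ (bondPercolation (zdGraph 2) half).real {ω : BondConfig (Site 2) | ∃ a ∈ (LatticeDobrushin.threeSided (6 * n) (3 * n)).A, ω ∈ openConnIn {v : Site 2 | 0 ≤ v 0 ∧ v 0 ≤ ((6 * n : ℕ) : ℤ) ∧ 0 ≤ v 1 ∧ v 1 ≤ ((3 * n : ℕ) : ℤ)} ![(x : ℤ), 0] a} := by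
  obtain ⟨cU, hcU, mU, hU⟩ := HalfPlaneArm.real_U_ge (X := fun v : Site 2 => v 0)
    (Y := fun v : Site 2 => v 1) HalfPlaneArm.axis_X_le HalfPlaneArm.axis_Y_le
    HalfPlaneArm.axis_injective half HalfPlaneArm.axis_rswLR HalfPlaneArm.axis_rswTB
  obtain ⟨cT, hcT, mT, hT⟩ := HalfPlaneArm.tb_lower (X := fun v : Site 2 => v 0)
    (Y := fun v : Site 2 => v 1) HalfPlaneArm.axis_Y_le half HalfPlaneArm.axis_rswTB 1
  refine ⟨cU * cT, by positivity, max mU mT + 1, fun n hn x h2 h4 => ?_⟩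
  rw [HalfPlaneArm.axisArm_eq (2 * n)]
  have c2 : ((2 * n : ℕ) : ℤ) = 2 * (n : ℤ) := by push_cast; ring
  rw [c2]
  generalize hb : (![(x : ℤ), 0] : Site 2) = b
  have hb0 : b 0 = x := by rw [← hb]; simp
  have hb1 : b 1 = 0 := by rw [← hb]; simp
  -- the two RSW lower bounds at the base point `b = (x, 0)` and scale `a = n`
  have eU := hU b n (by omega) (by omega) (by omega)
  have eT := hT (4 * n) (by omega) (b 0 - 2 * n) (b 1 + n) (2 * n) (by omega) (by push_cast; omega)
  have e1 : b 0 - 2 * (n : ℤ) + ((4 * n : ℕ) : ℤ) = b 0 + 2 * (n : ℤ) := by push_cast; ring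
  have e2 : b 1 + (n : ℤ) + 2 * (n : ℤ) = b 1 + 3 * (n : ℤ) := by ring
  rw [e1, e2] at eT
  -- the column `[x - 2n, x + 2n] × [0, 3n]` lies in the box and its top row in the wired arc
  have hcol : {ω : BondConfig (Site 2) | ∃ y : Site 2, y 1 = b 1 + 3 * (n : ℤ) ∧
      b 0 - 2 * (n : ℤ) ≤ y 0 ∧ y 0 ≤ b 0 + 2 * (n : ℤ) ∧
      ω ∈ openConnIn {v : Site 2 | b 0 - 2 * (n : ℤ) ≤ v 0 ∧ v 0 ≤ b 0 + 2 * (n : ℤ) ∧ 0 ≤ v 1 ∧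
        v 1 ≤ b 1 + 3 * (n : ℤ)} b y} ⊆
      {ω : BondConfig (Site 2) | ∃ a ∈ (LatticeDobrushin.threeSided (6 * n) (3 * n)).A,
        ω ∈ openConnIn {v : Site 2 | 0 ≤ v 0 ∧ v 0 ≤ ((6 * n : ℕ) : ℤ) ∧ 0 ≤ v 1 ∧
          v 1 ≤ ((3 * n : ℕ) : ℤ)} b a} := by
    rintro ω ⟨y, hy1, hy0, hy0', hconn⟩
    refine ⟨y, LatticeDobrushin.mem_threeSided_A.2
      ⟨⟨by omega, by omega, by omega, by omega⟩, by omega, Or.inr (Or.inr (by omega))⟩,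
      openConnIn_mono (fun v hv => ?_) _ _ hconn⟩
    obtain ⟨hv1, hv2, hv3, hv4⟩ := hv
    exact ⟨by omega, by omega, hv3, by omega⟩
  refine le_trans (mul_le_mul_of_nonneg_left (real_arm_shift_le_N5 hb1 _) (by positivity)) ?_
  exact (key_N5 hcT hb1 (by omega) eU eT).trans (measureReal_mono hcol (measure_ne_top _ _))

end

end Summit.CriticalPhenomena.CardyFormulaZ2.Cruxes.EdgePrecompact.QkzStripBoundaryArm
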